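import Literature.Geometry.Lorentzian.KerrDeSitterSuperradiantThresholds
import HarnessLib

/-!
# Venture KdS — BalancedFrequency.lean: the event–cosmological BALANCED FREQUENCY `Ω_bal` (the third
# horizon-pair balance), its `horizonB` characterisation, Vieta form, and the ordering `Ω_low < Ω_bal < Ω_SR`

HONEST FRAMING (venture `Summits/Ventures/KdS`, cell `pub-kds`; typing ask of lead g9, STRUCTURE.md §8 Q5b,
2026-08-23T06:46Z): VOCABULARY + elementary algebra only, fact-free. Casals–Teixeira da Costa's two real-axis
thresholds are horizon-PAIR balances of the phase rates `B(r_j) = iΞK(r_j)/Δ_r'(r_j)` (`horizonB`): for real `ω`,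
`ω = mΩ_low ⟺ B(r₋) = −B(r₊)` and `ω = mΩ_SR ⟺ B(r₋) = −B(r_c)` (the tree's
`superradiantLower_eq_weighted` / `superradiantUpper_eq_weighted` give the κ-weighted means). This file TYPES the same
construction on the third pair (event, cosmological),
`Ω_bal := (ϖ₁/κ₁ + ϖ₂/κ₂)/(1/κ₁ + 1/κ₂)` (`eventCosmoBalanced`), and PROVES: `ω = m·Ω_bal ⟺ B(r₊) = +B(r_c)`
(`horizonB_rPlus_eq_horizonB_rCosmo_iff`, every subextremal `(M,a,Λ)`, every real `ω`, `m`), the Vieta form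
`Ω_bal = 2aP/R` with `P = (r₊+r_c)² − r₊r_c − r₋(r₋+r₊+r_c)`,
`R = (r_c²+a²)(r₊−r₋)(r₋+2r₊+r_c) + (r₊²+a²)(r_c−r₋)(r₋+r₊+2r_c)` (`eventCosmoBalanced_eq_vieta`), and the
GENERAL ordering `Ω_low < Ω_bal < Ω_SR` for `a > 0` (`superradiantLower_lt_eventCosmoBalanced`,
`eventCosmoBalanced_lt_superradiantUpper`) via the factorisations
`R − P·(a²+3/Λ−(r₋+r_c)²) = (r₊−r₋)(r_c−r₊)(r₋+r₊)(r₋+r₊+2r_c)` and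
`P·(a²+3/Λ−(r₋+r₊)²) − R = (r_c−r₋)(r_c−r₊)(r₋+r_c)(r₋+2r₊+r_c)` (both independent of `a²`); plus the two CTdC
balances as `horizonB` equivalences. No `2a/(a²+3/Λ−Q)` form with `Q` a square of a root sum exists for `Ω_bal`.
Vocabulary for a possible 4th structure conjecture (lead g9, P-015); the file asserts NOTHING about modes,
certificates or stability. No `sorry`, no axiom, no cited fact consumed.
-/

noncomputable section

open Complex

namespace Summit.Ventures.KdS

open Literature.Geometry.Lorentzian Literature.Geometry.Lorentzian.KerrDeSitter

variable {M a Λ : ℝ}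

/-! ### The balanced frequency -/

/-- **The event–cosmological balanced frequency** `Ω_bal = (ϖ₁/κ₁ + ϖ₂/κ₂)/(1/κ₁ + 1/κ₂)`: the
surface-gravity-weighted mean of the horizon angular velocities of `r₊ = rPlus` and `r_c = rCosmo` — CTdC's
construction (`Ω_SR`: pair `r₋, r_c`; `Ω_low`: pair `r₋, r₊` with a sign) on the third pair. -/
def eventCosmoBalanced (M a Λ : ℝ) : ℝ :=
  (horizonAngVel a (rPlus M a Λ) / surfaceGravity M a Λ (rPlus M a Λ) +
      horizonAngVel a (rCosmo M a Λ) / surfaceGravity M a Λ (rCosmo M a Λ)) /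
    (1 / surfaceGravity M a Λ (rPlus M a Λ) + 1 / surfaceGravity M a Λ (rCosmo M a Λ))

/-- `3/Λ = a² + s² − e₂` (Vieta; local twin of the private lemma of `KerrDeSitterSuperradiantThresholds`). -/
private theorem three_div_eq' (hsub : IsSubextremal M a Λ) :
    3 / Λ = a ^ 2 + (rMinus M a Λ + rPlus M a Λ + rCosmo M a Λ) ^ 2 -
      (rMinus M a Λ * rPlus M a Λ + rPlus M a Λ * rCosmo M a Λ + rCosmo M a Λ * rMinus M a Λ) := by
  have hv := vieta_sq hsub
  rw [div_eq_iff hsub.2.1.ne']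
  linear_combination 3 * hv

/-- `Ω_bal = a(Δ_r'(r₊) − Δ_r'(r_c))/((r_c²+a²)Δ_r'(r₊) − (r₊²+a²)Δ_r'(r_c))` (`Δ_r'(r₊) > 0 > Δ_r'(r_c)`). -/
theorem eventCosmoBalanced_eq_deltaDeriv (hsub : IsSubextremal M a Λ) :
    eventCosmoBalanced M a Λ =
      a * (deltaDeriv M a Λ (rPlus M a Λ) - deltaDeriv M a Λ (rCosmo M a Λ)) /
        ((rCosmo M a Λ ^ 2 + a ^ 2) * deltaDeriv M a Λ (rPlus M a Λ) -
          (rPlus M a Λ ^ 2 + a ^ 2) * deltaDeriv M a Λ (rCosmo M a Λ)) := by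
  have hD1 := deltaDeriv_rPlus_pos hsub
  have hD2 := deltaDeriv_rCosmo_neg hsub
  have hξ := xi_pos hsub.2.1.le a
  unfold eventCosmoBalanced surfaceGravity horizonAngVel
  rw [abs_of_pos hD1, abs_of_neg hD2]
  set D1 := deltaDeriv M a Λ (rPlus M a Λ)
  set D2 := deltaDeriv M a Λ (rCosmo M a Λ)
  set y := rPlus M a Λ
  set z := rCosmo M a Λ
  have hya : 0 < y ^ 2 + a ^ 2 := by
    have h0 := rMinus_nonneg M a Λ
    have hy : 0 < y := lt_of_le_of_lt h0 hsub.2.2.1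
    positivity
  have hza : 0 < z ^ 2 + a ^ 2 := by
    have h0 := rMinus_nonneg M a Λ
    have hz : 0 < z := (lt_of_le_of_lt h0 hsub.2.2.1).trans hsub.2.2.2.1
    positivity
  have hW : 0 < (z ^ 2 + a ^ 2) * D1 - (y ^ 2 + a ^ 2) * D2 := by nlinarith [mul_pos hza hD1, mul_pos hya (neg_pos.mpr hD2)]
  have hD1' : D1 ≠ 0 := hD1.ne'
  have hD2' : D2 ≠ 0 := hD2.ne
  have hξ' : xi a Λ ≠ 0 := hξ.ne'
  have hκ1 : 0 < D1 / (2 * xi a Λ * (y ^ 2 + a ^ 2)) := by positivity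
  have hκ2 : 0 < -D2 / (2 * xi a Λ * (z ^ 2 + a ^ 2)) := by
    have := neg_pos.mpr hD2
    positivity
  have hsum : 1 / (D1 / (2 * xi a Λ * (y ^ 2 + a ^ 2))) + 1 / (-D2 / (2 * xi a Λ * (z ^ 2 + a ^ 2))) ≠ 0 := by
    have : 0 < 1 / (D1 / (2 * xi a Λ * (y ^ 2 + a ^ 2))) + 1 / (-D2 / (2 * xi a Λ * (z ^ 2 + a ^ 2))) := by
      positivity
    exact this.ne'
  rw [div_eq_div_iff hsum hW.ne']
  field_simp
  ring

/-- For REAL `ω`: `B(r_h) = i·Ξ(ω(r_h²+a²) − am)/Δ_r'(r_h)` (`i` times a real number). -/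
theorem horizonB_ofReal (M a Λ ω m rh : ℝ) :
    horizonB M a Λ (ω : ℂ) m rh =
      ((xi a Λ * (ω * (rh ^ 2 + a ^ 2) - a * m) / deltaDeriv M a Λ rh : ℝ) : ℂ) * I := by
  unfold horizonB radialK
  push_cast
  ring

/-- **`ω = m·Ω_bal ⟺ B(r₊) = +B(r_c)`** for real `ω` on every subextremal Kerr–de Sitter: at `Ω_bal` the phase
rates of the two OUTER horizons coincide (same sign), as `Ω_low`/`Ω_SR` are where the Cauchy rate matches
`−B(r₊)` / `−B(r_c)`. No hypothesis on `a` or `m` is needed. -/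
theorem horizonB_rPlus_eq_horizonB_rCosmo_iff (hsub : IsSubextremal M a Λ) (ω m : ℝ) :
    horizonB M a Λ (ω : ℂ) m (rPlus M a Λ) = horizonB M a Λ (ω : ℂ) m (rCosmo M a Λ) ↔
      ω = m * eventCosmoBalanced M a Λ := by
  have hD1 := deltaDeriv_rPlus_pos hsub
  have hD2 := deltaDeriv_rCosmo_neg hsub
  have hξ := xi_pos hsub.2.1.le a
  rw [horizonB_ofReal, horizonB_ofReal, mul_left_inj' I_ne_zero, ofReal_inj,
    eventCosmoBalanced_eq_deltaDeriv hsub]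
  set D1 := deltaDeriv M a Λ (rPlus M a Λ)
  set D2 := deltaDeriv M a Λ (rCosmo M a Λ)
  set y := rPlus M a Λ
  set z := rCosmo M a Λ
  have hya : 0 < y ^ 2 + a ^ 2 := by
    have h0 := rMinus_nonneg M a Λ
    have hy : 0 < y := lt_of_le_of_lt h0 hsub.2.2.1
    positivity
  have hza : 0 < z ^ 2 + a ^ 2 := by
    have h0 := rMinus_nonneg M a Λ
    have hz : 0 < z := (lt_of_le_of_lt h0 hsub.2.2.1).trans hsub.2.2.2.1
    positivity
  have hW : 0 < (z ^ 2 + a ^ 2) * D1 - (y ^ 2 + a ^ 2) * D2 := by nlinarith [mul_pos hza hD1, mul_pos hya (neg_pos.mpr hD2)]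
  rw [div_eq_div_iff hD1.ne' hD2.ne, ← mul_div_assoc, eq_div_iff hW.ne']
  constructor
  · intro h
    have h2 : xi a Λ * ((ω * (y ^ 2 + a ^ 2) - a * m) * D2) =
        xi a Λ * ((ω * (z ^ 2 + a ^ 2) - a * m) * D1) := by
      rw [← mul_assoc, ← mul_assoc]; exact h
    have h' : (ω * (y ^ 2 + a ^ 2) - a * m) * D2 = (ω * (z ^ 2 + a ^ 2) - a * m) * D1 :=
      mul_left_cancel₀ hξ.ne' h2
    linear_combination (-1 : ℝ) * h'
  · intro h
    linear_combination (-(xi a Λ)) * h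

/-! ### Vieta form and the ordering `Ω_low < Ω_bal < Ω_SR` -/

/-- **Vieta form of `Ω_bal`** (`x = r₋`, `y = r₊`, `z = r_c`): `Ω_bal = 2aP/R`, `P = (y+z)² − yz − x(x+y+z)`,
`R = (z²+a²)(y−x)(x+2y+z) + (y²+a²)(z−x)(x+y+2z)` (product forms (3.10) of `Δ_r'`; `N₁ + N₂ = 2(z−y)P`). -/
theorem eventCosmoBalanced_eq_vieta (hsub : IsSubextremal M a Λ) :
    eventCosmoBalanced M a Λ =
      2 * a * ((rPlus M a Λ + rCosmo M a Λ) ^ 2 - rPlus M a Λ * rCosmo M a Λ -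
          rMinus M a Λ * (rMinus M a Λ + rPlus M a Λ + rCosmo M a Λ)) /
        ((rCosmo M a Λ ^ 2 + a ^ 2) * (rPlus M a Λ - rMinus M a Λ) *
            (rMinus M a Λ + 2 * rPlus M a Λ + rCosmo M a Λ) +
          (rPlus M a Λ ^ 2 + a ^ 2) * (rCosmo M a Λ - rMinus M a Λ) *
            (rMinus M a Λ + rPlus M a Λ + 2 * rCosmo M a Λ)) := by
  rw [eventCosmoBalanced_eq_deltaDeriv hsub, deltaDeriv_rPlus_eq hsub, deltaDeriv_rCosmo_eq hsub]
  have h0 := rMinus_nonneg M a Λ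
  obtain ⟨hM, hΛ, h01, h12, -⟩ := hsub
  set x := rMinus M a Λ
  set y := rPlus M a Λ
  set z := rCosmo M a Λ
  have hy : 0 < y := lt_of_le_of_lt h0 h01
  have hz : 0 < z := hy.trans h12
  have hΛ3 : 0 < Λ / 3 := by positivity
  have hR : 0 < (z ^ 2 + a ^ 2) * (y - x) * (x + 2 * y + z) + (y ^ 2 + a ^ 2) * (z - x) * (x + y + 2 * z) := by
    have h1 : 0 < (z ^ 2 + a ^ 2) * (y - x) * (x + 2 * y + z) :=
      mul_pos (mul_pos (by positivity) (by linarith)) (by linarith)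
    have h2 : 0 < (y ^ 2 + a ^ 2) * (z - x) * (x + y + 2 * z) :=
      mul_pos (mul_pos (by positivity) (by linarith)) (by linarith)
    linarith
  have hden : (z ^ 2 + a ^ 2) * (-(Λ / 3) * (y - x) * (y - z) * (x + 2 * y + z)) -
      (y ^ 2 + a ^ 2) * (-(Λ / 3) * (z - x) * (z - y) * (x + y + 2 * z)) ≠ 0 := by
    have : (z ^ 2 + a ^ 2) * (-(Λ / 3) * (y - x) * (y - z) * (x + 2 * y + z)) -
        (y ^ 2 + a ^ 2) * (-(Λ / 3) * (z - x) * (z - y) * (x + y + 2 * z)) =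
        Λ / 3 * (z - y) * ((z ^ 2 + a ^ 2) * (y - x) * (x + 2 * y + z) +
          (y ^ 2 + a ^ 2) * (z - x) * (x + y + 2 * z)) := by ring
    rw [this]
    exact (mul_pos (mul_pos hΛ3 (by linarith)) hR).ne'
  rw [div_eq_div_iff hden hR.ne']
  ring

/-- The `Ω_SR` denominator by Vieta. -/
private theorem upperDen_eq' (hsub : IsSubextremal M a Λ) :
    a ^ 2 + 3 / Λ - (rMinus M a Λ + rCosmo M a Λ) ^ 2 =
      2 * a ^ 2 + rPlus M a Λ ^ 2 + rPlus M a Λ * rMinus M a Λ +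
        rCosmo M a Λ * (rPlus M a Λ - rMinus M a Λ) := by
  rw [three_div_eq' hsub]; ring

/-- The `Ω_low` denominator by Vieta. -/
private theorem lowerDen_eq' (hsub : IsSubextremal M a Λ) :
    a ^ 2 + 3 / Λ - (rMinus M a Λ + rPlus M a Λ) ^ 2 =
      2 * a ^ 2 + rCosmo M a Λ ^ 2 + rCosmo M a Λ * rMinus M a Λ +
        rPlus M a Λ * (rCosmo M a Λ - rMinus M a Λ) := by
  rw [three_div_eq' hsub]; ring

/-- **`Ω_bal < Ω_SR`** on every subextremal Kerr–de Sitter with `a > 0`: by Vieta,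
`R − P·(a²+3/Λ−(r₋+r_c)²) = (r₊−r₋)(r_c−r₊)(r₋+r₊)(r₋+r₊+2r_c) > 0` (independent of `a²`). -/
theorem eventCosmoBalanced_lt_superradiantUpper (hsub : IsSubextremal M a Λ) (ha : 0 < a) :
    eventCosmoBalanced M a Λ < superradiantUpper M a Λ := by
  rw [eventCosmoBalanced_eq_vieta hsub]
  unfold superradiantUpper
  rw [upperDen_eq' hsub]
  have h0 := rMinus_nonneg M a Λ
  obtain ⟨hM, hΛ, h01, h12, -⟩ := hsub
  set x := rMinus M a Λ
  set y := rPlus M a Λ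
  set z := rCosmo M a Λ
  have hy : 0 < y := lt_of_le_of_lt h0 h01
  have hz : 0 < z := hy.trans h12
  have hR : 0 < (z ^ 2 + a ^ 2) * (y - x) * (x + 2 * y + z) + (y ^ 2 + a ^ 2) * (z - x) * (x + y + 2 * z) := by
    have h1 : 0 < (z ^ 2 + a ^ 2) * (y - x) * (x + 2 * y + z) :=
      mul_pos (mul_pos (by positivity) (by linarith)) (by linarith)
    have h2 : 0 < (y ^ 2 + a ^ 2) * (z - x) * (x + y + 2 * z) :=
      mul_pos (mul_pos (by positivity) (by linarith)) (by linarith)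
    linarith
  have hD : 0 < 2 * a ^ 2 + y ^ 2 + y * x + z * (y - x) := by
    have h1 : 0 ≤ y * x := mul_nonneg hy.le h0
    have h2 : 0 < z * (y - x) := mul_pos hz (by linarith)
    positivity
  rw [div_lt_div_iff₀ hR hD]
  have hF : 0 < (y - x) * (z - y) * (x + y) * (x + y + 2 * z) :=
    mul_pos (mul_pos (mul_pos (by linarith) (by linarith)) (by linarith)) (by linarith)
  have key : 2 * a * ((z ^ 2 + a ^ 2) * (y - x) * (x + 2 * y + z) +
        (y ^ 2 + a ^ 2) * (z - x) * (x + y + 2 * z)) -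
      2 * a * ((y + z) ^ 2 - y * z - x * (x + y + z)) * (2 * a ^ 2 + y ^ 2 + y * x + z * (y - x)) =
      2 * a * ((y - x) * (z - y) * (x + y) * (x + y + 2 * z)) := by ring
  have hpos : 0 < 2 * a * ((y - x) * (z - y) * (x + y) * (x + y + 2 * z)) := by positivity
  rw [← key] at hpos
  linarith

/-- **`Ω_low < Ω_bal`** on every subextremal Kerr–de Sitter with `a > 0`: by Vieta,
`P·(a²+3/Λ−(r₋+r₊)²) − R = (r_c−r₋)(r_c−r₊)(r₋+r_c)(r₋+2r₊+r_c) > 0` (independent of `a²`). -/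
theorem superradiantLower_lt_eventCosmoBalanced (hsub : IsSubextremal M a Λ) (ha : 0 < a) :
    superradiantLower M a Λ < eventCosmoBalanced M a Λ := by
  rw [eventCosmoBalanced_eq_vieta hsub]
  unfold superradiantLower
  rw [lowerDen_eq' hsub]
  have h0 := rMinus_nonneg M a Λ
  obtain ⟨hM, hΛ, h01, h12, -⟩ := hsub
  set x := rMinus M a Λ
  set y := rPlus M a Λ
  set z := rCosmo M a Λ
  have hy : 0 < y := lt_of_le_of_lt h0 h01
  have hz : 0 < z := hy.trans h12
  have hR : 0 < (z ^ 2 + a ^ 2) * (y - x) * (x + 2 * y + z) + (y ^ 2 + a ^ 2) * (z - x) * (x + y + 2 * z) := by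
    have h1 : 0 < (z ^ 2 + a ^ 2) * (y - x) * (x + 2 * y + z) :=
      mul_pos (mul_pos (by positivity) (by linarith)) (by linarith)
    have h2 : 0 < (y ^ 2 + a ^ 2) * (z - x) * (x + y + 2 * z) :=
      mul_pos (mul_pos (by positivity) (by linarith)) (by linarith)
    linarith
  have hD : 0 < 2 * a ^ 2 + z ^ 2 + z * x + y * (z - x) := by
    have h1 : 0 ≤ z * x := mul_nonneg hz.le h0
    have h2 : 0 < y * (z - x) := mul_pos hy (by linarith)
    positivity
  rw [div_lt_div_iff₀ hD hR]
  have key : 2 * a * ((y + z) ^ 2 - y * z - x * (x + y + z)) * (2 * a ^ 2 + z ^ 2 + z * x + y * (z - x)) -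
      2 * a * ((z ^ 2 + a ^ 2) * (y - x) * (x + 2 * y + z) +
        (y ^ 2 + a ^ 2) * (z - x) * (x + y + 2 * z)) =
      2 * a * ((z - x) * (z - y) * (x + z) * (x + 2 * y + z)) := by ring
  have hpos : 0 < 2 * a * ((z - x) * (z - y) * (x + z) * (x + 2 * y + z)) := by
    have hF : 0 < (z - x) * (z - y) * (x + z) * (x + 2 * y + z) :=
      mul_pos (mul_pos (mul_pos (by linarith) (by linarith)) (by linarith)) (by linarith)
    positivity
  rw [← key] at hpos
  linarith

/-- The chain `0 < ϖ₂ < Ω_low < Ω_bal < Ω_SR < ϖ₁` on every subextremal Kerr–de Sitter with `a > 0`. -/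
theorem balanced_chain (hsub : IsSubextremal M a Λ) (ha : 0 < a) :
    0 < horizonAngVel a (rCosmo M a Λ) ∧
      horizonAngVel a (rCosmo M a Λ) < superradiantLower M a Λ ∧
      superradiantLower M a Λ < eventCosmoBalanced M a Λ ∧
      eventCosmoBalanced M a Λ < superradiantUpper M a Λ ∧
      superradiantUpper M a Λ < horizonAngVel a (rPlus M a Λ) := by
  obtain ⟨h1, h2, -, h4⟩ := superradiant_chain hsub ha
  exact ⟨h1, h2, superradiantLower_lt_eventCosmoBalanced hsub ha,
    eventCosmoBalanced_lt_superradiantUpper hsub ha, h4⟩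

/-! ### For completeness: CTdC's two thresholds as `horizonB` balances -/

/-- **`ω = m·Ω_SR ⟺ B(r₋) = −B(r_c)`** (real `ω`, every subextremal KdS): the Cauchy rate cancels the cosmological
one; key identity `(ω(r₋²+a²)−am)Δ_r'(r_c) + (ω(r_c²+a²)−am)Δ_r'(r₋) = −(Λ/3)(r_c−r₋)²(r₋+r_c)(ω·D_SR − 2am)`. -/
theorem horizonB_rMinus_eq_neg_horizonB_rCosmo_iff (hsub : IsSubextremal M a Λ) (ω m : ℝ) :
    horizonB M a Λ (ω : ℂ) m (rMinus M a Λ) = -horizonB M a Λ (ω : ℂ) m (rCosmo M a Λ) ↔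
      ω = m * superradiantUpper M a Λ := by
  have hξ := xi_pos hsub.2.1.le a
  have hDe := upperDen_eq' hsub
  have hD0e := deltaDeriv_rMinus_eq hsub
  have hD2e := deltaDeriv_rCosmo_eq hsub
  have h0 := rMinus_nonneg M a Λ
  rw [horizonB_ofReal, horizonB_ofReal, ← neg_mul, ← ofReal_neg, mul_left_inj' I_ne_zero, ofReal_inj]
  unfold superradiantUpper
  rw [hDe]
  obtain ⟨hM, hΛ, h01, h12, -⟩ := hsub
  set x := rMinus M a Λ
  set y := rPlus M a Λ
  set z := rCosmo M a Λ
  set D0 := deltaDeriv M a Λ x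
  set D2 := deltaDeriv M a Λ z
  have hy : 0 < y := lt_of_le_of_lt h0 h01
  have hz : 0 < z := hy.trans h12
  have hΛ3 : 0 < Λ / 3 := by positivity
  have hD0 : D0 < 0 := by
    rw [hD0e]
    have : 0 < Λ / 3 * (y - x) * (z - x) * (2 * x + y + z) :=
      mul_pos (mul_pos (mul_pos hΛ3 (by linarith)) (by linarith)) (by linarith)
    nlinarith
  have hD2 : D2 < 0 := by
    rw [hD2e]
    have : 0 < Λ / 3 * (z - x) * (z - y) * (x + y + 2 * z) :=
      mul_pos (mul_pos (mul_pos hΛ3 (by linarith)) (by linarith)) (by linarith)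
    nlinarith
  have hD : 0 < 2 * a ^ 2 + y ^ 2 + y * x + z * (y - x) := by
    have h1 : 0 ≤ y * x := mul_nonneg hy.le h0
    have h2 : 0 < z * (y - x) := mul_pos hz (by linarith)
    positivity
  have hc : 0 < Λ / 3 * (z - x) ^ 2 * (x + z) := mul_pos (mul_pos hΛ3 (by nlinarith)) (by linarith)
  -- the numerator identity
  have key : (ω * (x ^ 2 + a ^ 2) - a * m) * D2 + (ω * (z ^ 2 + a ^ 2) - a * m) * D0 =
      -(Λ / 3 * (z - x) ^ 2 * (x + z)) * (ω * (2 * a ^ 2 + y ^ 2 + y * x + z * (y - x)) - 2 * a * m) := by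
    rw [hD0e, hD2e]; ring
  have e1 : xi a Λ * (ω * (x ^ 2 + a ^ 2) - a * m) / D0 = -(xi a Λ * (ω * (z ^ 2 + a ^ 2) - a * m) / D2) ↔
      xi a Λ * ((ω * (x ^ 2 + a ^ 2) - a * m) * D2 + (ω * (z ^ 2 + a ^ 2) - a * m) * D0) = 0 := by
    rw [eq_neg_iff_add_eq_zero, div_add_div _ _ hD0.ne hD2.ne, div_eq_zero_iff,
      or_iff_left (mul_ne_zero hD0.ne hD2.ne)]
    constructor <;> intro h <;> linear_combination h
  have e2 : ω = m * (2 * a / (2 * a ^ 2 + y ^ 2 + y * x + z * (y - x))) ↔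
      ω * (2 * a ^ 2 + y ^ 2 + y * x + z * (y - x)) = 2 * a * m := by
    rw [← mul_div_assoc, eq_div_iff hD.ne']
    constructor <;> intro h <;> linear_combination h
  rw [e1, e2, key]
  constructor
  · intro h
    rcases mul_eq_zero.mp h with h3 | h3
    · exact absurd h3 hξ.ne'
    · rcases mul_eq_zero.mp h3 with h4 | h4
      · exfalso; linarith
      · linarith
  · intro h
    rw [show ω * (2 * a ^ 2 + y ^ 2 + y * x + z * (y - x)) - 2 * a * m = 0 by linarith, mul_zero, mul_zero]

/-- **`ω = m·Ω_low ⟺ B(r₋) = −B(r₊)`** (real `ω`, every subextremal KdS): the Cauchy rate cancels the event one;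
key identity `(ω(r₋²+a²)−am)Δ_r'(r₊) + (ω(r₊²+a²)−am)Δ_r'(r₋) = −(Λ/3)(r₊−r₋)²(r₋+r₊)(ω·D_low − 2am)`. -/
theorem horizonB_rMinus_eq_neg_horizonB_rPlus_iff (hsub : IsSubextremal M a Λ) (ω m : ℝ) :
    horizonB M a Λ (ω : ℂ) m (rMinus M a Λ) = -horizonB M a Λ (ω : ℂ) m (rPlus M a Λ) ↔
      ω = m * superradiantLower M a Λ := by
  have hξ := xi_pos hsub.2.1.le a
  have hDe := lowerDen_eq' hsub
  have hD0e := deltaDeriv_rMinus_eq hsub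
  have hD1e := deltaDeriv_rPlus_eq hsub
  have h0 := rMinus_nonneg M a Λ
  rw [horizonB_ofReal, horizonB_ofReal, ← neg_mul, ← ofReal_neg, mul_left_inj' I_ne_zero, ofReal_inj]
  unfold superradiantLower
  rw [hDe]
  obtain ⟨hM, hΛ, h01, h12, -⟩ := hsub
  set x := rMinus M a Λ
  set y := rPlus M a Λ
  set z := rCosmo M a Λ
  set D0 := deltaDeriv M a Λ x
  set D1 := deltaDeriv M a Λ y
  have hy : 0 < y := lt_of_le_of_lt h0 h01
  have hz : 0 < z := hy.trans h12
  have hΛ3 : 0 < Λ / 3 := by positivity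
  have hD0 : D0 < 0 := by
    rw [hD0e]
    have : 0 < Λ / 3 * (y - x) * (z - x) * (2 * x + y + z) :=
      mul_pos (mul_pos (mul_pos hΛ3 (by linarith)) (by linarith)) (by linarith)
    nlinarith
  have hD1 : 0 < D1 := by
    rw [hD1e]
    have : 0 < Λ / 3 * (y - x) * (z - y) * (x + 2 * y + z) :=
      mul_pos (mul_pos (mul_pos hΛ3 (by linarith)) (by linarith)) (by linarith)
    nlinarith
  have hD : 0 < 2 * a ^ 2 + z ^ 2 + z * x + y * (z - x) := by
    have h1 : 0 ≤ z * x := mul_nonneg hz.le h0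
    have h2 : 0 < y * (z - x) := mul_pos hy (by linarith)
    positivity
  have hc : 0 < Λ / 3 * (y - x) ^ 2 * (x + y) := mul_pos (mul_pos hΛ3 (by nlinarith)) (by linarith)
  have key : (ω * (x ^ 2 + a ^ 2) - a * m) * D1 + (ω * (y ^ 2 + a ^ 2) - a * m) * D0 =
      -(Λ / 3 * (y - x) ^ 2 * (x + y)) * (ω * (2 * a ^ 2 + z ^ 2 + z * x + y * (z - x)) - 2 * a * m) := by
    rw [hD0e, hD1e]; ring
  have e1 : xi a Λ * (ω * (x ^ 2 + a ^ 2) - a * m) / D0 = -(xi a Λ * (ω * (y ^ 2 + a ^ 2) - a * m) / D1) ↔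
      xi a Λ * ((ω * (x ^ 2 + a ^ 2) - a * m) * D1 + (ω * (y ^ 2 + a ^ 2) - a * m) * D0) = 0 := by
    rw [eq_neg_iff_add_eq_zero, div_add_div _ _ hD0.ne hD1.ne', div_eq_zero_iff,
      or_iff_left (mul_ne_zero hD0.ne hD1.ne')]
    constructor <;> intro h <;> linear_combination h
  have e2 : ω = m * (2 * a / (2 * a ^ 2 + z ^ 2 + z * x + y * (z - x))) ↔
      ω * (2 * a ^ 2 + z ^ 2 + z * x + y * (z - x)) = 2 * a * m := by
    rw [← mul_div_assoc, eq_div_iff hD.ne']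
    constructor <;> intro h <;> linear_combination h
  rw [e1, e2, key]
  constructor
  · intro h
    rcases mul_eq_zero.mp h with h3 | h3
    · exact absurd h3 hξ.ne'
    · rcases mul_eq_zero.mp h3 with h4 | h4
      · exfalso; linarith
      · linarith
  · intro h
    rw [show ω * (2 * a ^ 2 + z ^ 2 + z * x + y * (z - x)) - 2 * a * m = 0 by linarith, mul_zero, mul_zero]

end Summit.Ventures.KdS

end
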